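import Summits.Parity.GeneralizedHardyLittlewood.Theorems.PrimeLevelFamEdgeMomentsBeyondDiagonalDiagDecorOrderThreeThreeCombine
import HarnessLib

/-!
# Route `PrimeLevelFamEdge`, crux K_A `MomentsBeyondDiagonal` (stmt-Parity-20007), line «petersson_layers» v4, stub `stub_diag`:
# **bookkeeping of the order-`(2,4)` polynomial part (forty pieces, main order `log⁴M`)**

Order-`(2,4)` twin of `…DiagDecorOrderThreeThreeCombine` (p831802; its piece lemmas `poly33_piece_main/low/hyp` at main order `ℓ⁴`,
error `ℓ³`, are reused): the linear bookkeeping `orderTwoFour_combine`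
of the forty monomials of `…DiagDecorOrderTwoFourSplit.selbergOrderTwoFour_split` against abstract engine facts
(`ττL^m`: `|S_m − KΦ_mℓ^mℓ/ℓ⁴| ≤ C_mℓ^m/ℓ⁴`; `τP₂τL^m` (+ mirror): `…/ℓ²`; `τP₂τP₂L^m`: `…/ℓ⁰`; `M₄`-, `M₆`- and `M₄⊗P₂`-decorated
families: `|·| ≤ Cℓ^p`, `p ≤ 3`). Pure real-number algebra (`poly22_add_piece` reused).

Def-free; theorems only. Helper `--supports stmt-Parity-20007`; closes nothing; K_A, K_B and the Parity summit are NOT proved;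
nothing about Landau–Siegel zeros.

## References
* E. Kowalski, P. Michel, J. VanderKam, J. reine angew. Math. 526 (2000), (23)–(28) pp. 13–15 and Prop. 5.1 p. 18.
  [cite: KowalskiMichelVanderKam2000, (23)–(28) — derivation (order-(2,4) piece of the diagonal main term, general Q)]
-/

noncomputable section

open scoped Real ArithmeticFunction.Moebius

namespace Summit.Parity.GeneralizedHardyLittlewood.Theorems.MomentsBeyondDiagonal.DiagKernel

/-! ### The forty pieces of order `(2,4)` -/
set_option maxHeartbeats 1600000 in
-- forty-term linear bookkeeping
/-- **The bookkeeping of the forty pieces at order `(2,4)`** (`K = (π²/6)²`, `ℓ = log M ≥ 1`): the top-degree pieces `S₇`,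
`T₅`, `T₅'`, `U₃` carry the main term `K(Φ₇/896 − Ψ₅/320 − Ξ₃/64)ℓ⁴`, the other thirty-six are `O(ℓ³)`. [folklore] -/
theorem orderTwoFour_combine
    {S₇ S₆ S₅ S₄ S₃ S₂ S₁ S₀ T₅ T₄ T₃ T₂ T₁ T₀ T₅' T₄' T₃' T₂' T₁' T₀' U₃ U₂ U₁ U₀ V₃ V₂ V₁ V₀ W₃ W₂ W₁ W₀ Y₁ Y₀ Z₁ Z₀ R₁ R₀ R₁' R₀' : ℝ}
    {Φ₇ Φ₆ Φ₅ Φ₄ Φ₃ Φ₂ Φ₁ Φ₀ Ψ₅ Ψ₄ Ψ₃ Ψ₂ Ψ₁ Ψ₀ Ξ₃ Ξ₂ Ξ₁ Ξ₀ : ℝ}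
    {C₇ C₆ C₅ C₄ C₃ C₂ C₁ C₀ D₅ D₄ D₃ D₂ D₁ D₀ D₅' D₄' D₃' D₂' D₁' D₀' G₃ G₂ G₁ G₀ A₃ A₂ A₁ A₀ B₃ B₂ B₁ B₀ CY₁ CY₀ CZ₁ CZ₀ CR₁ CR₀ CR₁' CR₀' : ℝ}
    {E₀₀ E₀₁ E₀₂ E₀₃ E₀₄ E₁₀ E₁₁ E₁₂ E₁₃ E₁₄ E₂₀ E₂₁ E₂₂ E₂₃ E₂₄ μ₂ μ₄ μ₆ ℓ K : ℝ} (hℓ : 1 ≤ ℓ) (hK : 0 ≤ K)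
    (hC₆ : 0 ≤ C₆) (hC₅ : 0 ≤ C₅) (hC₄ : 0 ≤ C₄) (hC₃ : 0 ≤ C₃) (hC₂ : 0 ≤ C₂) (hC₁ : 0 ≤ C₁) (hC₀ : 0 ≤ C₀) (hD₄ : 0 ≤ D₄) (hD₃ : 0 ≤ D₃) (hD₂ : 0 ≤ D₂) (hD₁ : 0 ≤ D₁) (hD₀ : 0 ≤ D₀) (hD₄' : 0 ≤ D₄') (hD₃' : 0 ≤ D₃') (hD₂' : 0 ≤ D₂') (hD₁' : 0 ≤ D₁') (hD₀' : 0 ≤ D₀') (hG₂ : 0 ≤ G₂) (hG₁ : 0 ≤ G₁) (hG₀ : 0 ≤ G₀)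
    (h7 : |S₇ - K * Φ₇ * ℓ ^ 7 * ℓ / ℓ ^ 4| ≤ C₇ * ℓ ^ 7 / ℓ ^ 4)
    (h6 : |S₆ - K * Φ₆ * ℓ ^ 6 * ℓ / ℓ ^ 4| ≤ C₆ * ℓ ^ 6 / ℓ ^ 4)
    (h5 : |S₅ - K * Φ₅ * ℓ ^ 5 * ℓ / ℓ ^ 4| ≤ C₅ * ℓ ^ 5 / ℓ ^ 4)
    (h4 : |S₄ - K * Φ₄ * ℓ ^ 4 * ℓ / ℓ ^ 4| ≤ C₄ * ℓ ^ 4 / ℓ ^ 4)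
    (h3 : |S₃ - K * Φ₃ * ℓ ^ 3 * ℓ / ℓ ^ 4| ≤ C₃ * ℓ ^ 3 / ℓ ^ 4)
    (h2 : |S₂ - K * Φ₂ * ℓ ^ 2 * ℓ / ℓ ^ 4| ≤ C₂ * ℓ ^ 2 / ℓ ^ 4)
    (h1 : |S₁ - K * Φ₁ * ℓ ^ 1 * ℓ / ℓ ^ 4| ≤ C₁ * ℓ ^ 1 / ℓ ^ 4)
    (h0 : |S₀ - K * Φ₀ * ℓ ^ 0 * ℓ / ℓ ^ 4| ≤ C₀ * ℓ ^ 0 / ℓ ^ 4)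
    (g5 : |T₅ - K * Ψ₅ * ℓ ^ 5 * ℓ / ℓ ^ 2| ≤ D₅ * ℓ ^ 5 / ℓ ^ 2)
    (g4 : |T₄ - K * Ψ₄ * ℓ ^ 4 * ℓ / ℓ ^ 2| ≤ D₄ * ℓ ^ 4 / ℓ ^ 2)
    (g3 : |T₃ - K * Ψ₃ * ℓ ^ 3 * ℓ / ℓ ^ 2| ≤ D₃ * ℓ ^ 3 / ℓ ^ 2)
    (g2 : |T₂ - K * Ψ₂ * ℓ ^ 2 * ℓ / ℓ ^ 2| ≤ D₂ * ℓ ^ 2 / ℓ ^ 2)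
    (g1 : |T₁ - K * Ψ₁ * ℓ ^ 1 * ℓ / ℓ ^ 2| ≤ D₁ * ℓ ^ 1 / ℓ ^ 2)
    (g0 : |T₀ - K * Ψ₀ * ℓ ^ 0 * ℓ / ℓ ^ 2| ≤ D₀ * ℓ ^ 0 / ℓ ^ 2)
    (g5p : |T₅' - K * Ψ₅ * ℓ ^ 5 * ℓ / ℓ ^ 2| ≤ D₅' * ℓ ^ 5 / ℓ ^ 2)
    (g4p : |T₄' - K * Ψ₄ * ℓ ^ 4 * ℓ / ℓ ^ 2| ≤ D₄' * ℓ ^ 4 / ℓ ^ 2)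
    (g3p : |T₃' - K * Ψ₃ * ℓ ^ 3 * ℓ / ℓ ^ 2| ≤ D₃' * ℓ ^ 3 / ℓ ^ 2)
    (g2p : |T₂' - K * Ψ₂ * ℓ ^ 2 * ℓ / ℓ ^ 2| ≤ D₂' * ℓ ^ 2 / ℓ ^ 2)
    (g1p : |T₁' - K * Ψ₁ * ℓ ^ 1 * ℓ / ℓ ^ 2| ≤ D₁' * ℓ ^ 1 / ℓ ^ 2)
    (g0p : |T₀' - K * Ψ₀ * ℓ ^ 0 * ℓ / ℓ ^ 2| ≤ D₀' * ℓ ^ 0 / ℓ ^ 2)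
    (u3 : |U₃ - K * Ξ₃ * ℓ ^ 3 * ℓ / ℓ ^ 0| ≤ G₃ * ℓ ^ 3 / ℓ ^ 0)
    (u2 : |U₂ - K * Ξ₂ * ℓ ^ 2 * ℓ / ℓ ^ 0| ≤ G₂ * ℓ ^ 2 / ℓ ^ 0)
    (u1 : |U₁ - K * Ξ₁ * ℓ ^ 1 * ℓ / ℓ ^ 0| ≤ G₁ * ℓ ^ 1 / ℓ ^ 0)
    (u0 : |U₀ - K * Ξ₀ * ℓ ^ 0 * ℓ / ℓ ^ 0| ≤ G₀ * ℓ ^ 0 / ℓ ^ 0)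
    (a3 : |V₃| ≤ A₃ * ℓ ^ 3)
    (a2 : |V₂| ≤ A₂ * ℓ ^ 2)
    (a1 : |V₁| ≤ A₁ * ℓ ^ 1)
    (a0 : |V₀| ≤ A₀ * ℓ ^ 0)
    (b3 : |W₃| ≤ B₃ * ℓ ^ 3)
    (b2 : |W₂| ≤ B₂ * ℓ ^ 2)
    (b1 : |W₁| ≤ B₁ * ℓ ^ 1)
    (b0 : |W₀| ≤ B₀ * ℓ ^ 0)
    (y1 : |Y₁| ≤ CY₁ * ℓ ^ (1 + 2))
    (y0 : |Y₀| ≤ CY₀ * ℓ ^ (0 + 2))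
    (z1 : |Z₁| ≤ CZ₁ * ℓ ^ (1 + 2))
    (z0 : |Z₀| ≤ CZ₀ * ℓ ^ (0 + 2))
    (r1 : |R₁| ≤ CR₁ * ℓ ^ (1 + 2))
    (r0 : |R₀| ≤ CR₀ * ℓ ^ (0 + 2))
    (r1p : |R₁'| ≤ CR₁' * ℓ ^ (1 + 2))
    (r0p : |R₀'| ≤ CR₀' * ℓ ^ (0 + 2)) :
    |((1 / 896) * S₇ +
        (E₀₀ / 64) * S₆ +
        (E₀₁ / 8 + E₁₀ / 16 - μ₂ / 40) * S₅ +
        (3 * E₀₂ / 8 + E₁₁ / 2 + E₂₀ / 16) * S₄ +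
        (E₀₃ / 2 + 3 * E₁₂ / 2 + E₂₁ / 2 - μ₄ / 6) * S₃ +
        (E₀₄ / 4 + 2 * E₁₃ + 3 * E₂₂ / 2) * S₂ +
        (E₁₄ + 2 * E₂₃ + 2 * μ₆) * S₁ +
        E₂₄ * S₀ +
        (-1 / 640) * T₅ +
        (-E₀₀ / 64) * T₄ +
        (-E₀₁ / 4 + E₁₀ / 8 - μ₂ / 4) * T₃ +
        (-3 * E₀₂ / 4 + 3 * E₂₀ / 8) * T₂ +
        (-E₀₃ / 2 - 3 * E₁₂ / 2 + 3 * E₂₁ / 2 + 15 * μ₄ / 2) * T₁ +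
        (E₀₄ / 4 - 2 * E₁₃ + 3 * E₂₂ / 2) * T₀ +
        (-1 / 640) * T₅' +
        (-E₀₀ / 64) * T₄' +
        (-E₀₁ / 4 + E₁₀ / 8 - μ₂ / 4) * T₃' +
        (-3 * E₀₂ / 4 + 3 * E₂₀ / 8) * T₂' +
        (-E₀₃ / 2 - 3 * E₁₂ / 2 + 3 * E₂₁ / 2 + 15 * μ₄ / 2) * T₁' +
        (E₀₄ / 4 - 2 * E₁₃ + 3 * E₂₂ / 2) * T₀' +
        (-1 / 64) * U₃ +
        (-3 * E₀₀ / 32) * U₂ +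
        (3 * E₀₁ / 4 - 9 * E₁₀ / 8 + 45 * μ₂ / 4) * U₁ +
        (9 * E₀₂ / 4 - 3 * E₁₁ + 3 * E₂₀ / 8) * U₀ +
        (-1 / 384) * V₃ +
        (-E₀₀ / 64) * V₂ +
        (E₀₁ / 8 - 3 * E₁₀ / 16 + 15 * μ₂ / 8) * V₁ +
        (3 * E₀₂ / 8 - E₁₁ / 2 + E₂₀ / 16) * V₀ +
        (-1 / 384) * W₃ +
        (-E₀₀ / 64) * W₂ +
        (E₀₁ / 8 - 3 * E₁₀ / 16 + 15 * μ₂ / 8) * W₁ +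
        (3 * E₀₂ / 8 - E₁₁ / 2 + E₂₀ / 16) * W₀ +
        (1 / 128) * Y₁ +
        (E₀₀ / 64) * Y₀ +
        (1 / 128) * Z₁ +
        (E₀₀ / 64) * Z₀ +
        (15 / 128) * R₁ +
        (15 * E₀₀ / 64) * R₀ +
        (15 / 128) * R₁' +
        (15 * E₀₀ / 64) * R₀') -
        K * ((1 / 896) * Φ₇ + (-1 / 320) * Ψ₅ + (-1 / 64) * Ξ₃) * ℓ ^ 4| ≤
      (|((1 / 896) : ℝ)| * C₇ +
        |((E₀₀ / 64) : ℝ)| * (K * |Φ₆| + C₆) +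
        |((E₀₁ / 8 + E₁₀ / 16 - μ₂ / 40) : ℝ)| * (K * |Φ₅| + C₅) +
        |((3 * E₀₂ / 8 + E₁₁ / 2 + E₂₀ / 16) : ℝ)| * (K * |Φ₄| + C₄) +
        |((E₀₃ / 2 + 3 * E₁₂ / 2 + E₂₁ / 2 - μ₄ / 6) : ℝ)| * (K * |Φ₃| + C₃) +
        |((E₀₄ / 4 + 2 * E₁₃ + 3 * E₂₂ / 2) : ℝ)| * (K * |Φ₂| + C₂) +
        |((E₁₄ + 2 * E₂₃ + 2 * μ₆) : ℝ)| * (K * |Φ₁| + C₁) +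
        |(E₂₄ : ℝ)| * (K * |Φ₀| + C₀) +
        |((-1 / 640) : ℝ)| * D₅ +
        |((-E₀₀ / 64) : ℝ)| * (K * |Ψ₄| + D₄) +
        |((-E₀₁ / 4 + E₁₀ / 8 - μ₂ / 4) : ℝ)| * (K * |Ψ₃| + D₃) +
        |((-3 * E₀₂ / 4 + 3 * E₂₀ / 8) : ℝ)| * (K * |Ψ₂| + D₂) +
        |((-E₀₃ / 2 - 3 * E₁₂ / 2 + 3 * E₂₁ / 2 + 15 * μ₄ / 2) : ℝ)| * (K * |Ψ₁| + D₁) +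
        |((E₀₄ / 4 - 2 * E₁₃ + 3 * E₂₂ / 2) : ℝ)| * (K * |Ψ₀| + D₀) +
        |((-1 / 640) : ℝ)| * D₅' +
        |((-E₀₀ / 64) : ℝ)| * (K * |Ψ₄| + D₄') +
        |((-E₀₁ / 4 + E₁₀ / 8 - μ₂ / 4) : ℝ)| * (K * |Ψ₃| + D₃') +
        |((-3 * E₀₂ / 4 + 3 * E₂₀ / 8) : ℝ)| * (K * |Ψ₂| + D₂') +
        |((-E₀₃ / 2 - 3 * E₁₂ / 2 + 3 * E₂₁ / 2 + 15 * μ₄ / 2) : ℝ)| * (K * |Ψ₁| + D₁') +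
        |((E₀₄ / 4 - 2 * E₁₃ + 3 * E₂₂ / 2) : ℝ)| * (K * |Ψ₀| + D₀') +
        |((-1 / 64) : ℝ)| * G₃ +
        |((-3 * E₀₀ / 32) : ℝ)| * (K * |Ξ₂| + G₂) +
        |((3 * E₀₁ / 4 - 9 * E₁₀ / 8 + 45 * μ₂ / 4) : ℝ)| * (K * |Ξ₁| + G₁) +
        |((9 * E₀₂ / 4 - 3 * E₁₁ + 3 * E₂₀ / 8) : ℝ)| * (K * |Ξ₀| + G₀) +
        |((-1 / 384) : ℝ)| * A₃ +
        |((-E₀₀ / 64) : ℝ)| * A₂ +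
        |((E₀₁ / 8 - 3 * E₁₀ / 16 + 15 * μ₂ / 8) : ℝ)| * A₁ +
        |((3 * E₀₂ / 8 - E₁₁ / 2 + E₂₀ / 16) : ℝ)| * A₀ +
        |((-1 / 384) : ℝ)| * B₃ +
        |((-E₀₀ / 64) : ℝ)| * B₂ +
        |((E₀₁ / 8 - 3 * E₁₀ / 16 + 15 * μ₂ / 8) : ℝ)| * B₁ +
        |((3 * E₀₂ / 8 - E₁₁ / 2 + E₂₀ / 16) : ℝ)| * B₀ +
        |((1 / 128) : ℝ)| * CY₁ +
        |((E₀₀ / 64) : ℝ)| * CY₀ +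
        |((1 / 128) : ℝ)| * CZ₁ +
        |((E₀₀ / 64) : ℝ)| * CZ₀ +
        |((15 / 128) : ℝ)| * CR₁ +
        |((15 * E₀₀ / 64) : ℝ)| * CR₀ +
        |((15 / 128) : ℝ)| * CR₁' +
        |((15 * E₀₀ / 64) : ℝ)| * CR₀') * ℓ ^ 3 := by
  have q1 := poly33_piece_main ((1 / 896) : ℝ) hℓ rfl h7
  have q2 := poly33_piece_low ((E₀₀ / 64) : ℝ) hℓ hK hC₆ (by norm_num) h6
  have q3 := poly33_piece_low ((E₀₁ / 8 + E₁₀ / 16 - μ₂ / 40) : ℝ) hℓ hK hC₅ (by norm_num) h5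
  have q4 := poly33_piece_low ((3 * E₀₂ / 8 + E₁₁ / 2 + E₂₀ / 16) : ℝ) hℓ hK hC₄ (by norm_num) h4
  have q5 := poly33_piece_low ((E₀₃ / 2 + 3 * E₁₂ / 2 + E₂₁ / 2 - μ₄ / 6) : ℝ) hℓ hK hC₃ (by norm_num) h3
  have q6 := poly33_piece_low ((E₀₄ / 4 + 2 * E₁₃ + 3 * E₂₂ / 2) : ℝ) hℓ hK hC₂ (by norm_num) h2
  have q7 := poly33_piece_low ((E₁₄ + 2 * E₂₃ + 2 * μ₆) : ℝ) hℓ hK hC₁ (by norm_num) h1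
  have q8 := poly33_piece_low (E₂₄ : ℝ) hℓ hK hC₀ (by norm_num) h0
  have q9 := poly33_piece_main ((-1 / 640) : ℝ) hℓ rfl g5
  have q10 := poly33_piece_low ((-E₀₀ / 64) : ℝ) hℓ hK hD₄ (by norm_num) g4
  have q11 := poly33_piece_low ((-E₀₁ / 4 + E₁₀ / 8 - μ₂ / 4) : ℝ) hℓ hK hD₃ (by norm_num) g3
  have q12 := poly33_piece_low ((-3 * E₀₂ / 4 + 3 * E₂₀ / 8) : ℝ) hℓ hK hD₂ (by norm_num) g2
  have q13 := poly33_piece_low ((-E₀₃ / 2 - 3 * E₁₂ / 2 + 3 * E₂₁ / 2 + 15 * μ₄ / 2) : ℝ) hℓ hK hD₁ (by norm_num) g1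
  have q14 := poly33_piece_low ((E₀₄ / 4 - 2 * E₁₃ + 3 * E₂₂ / 2) : ℝ) hℓ hK hD₀ (by norm_num) g0
  have q15 := poly33_piece_main ((-1 / 640) : ℝ) hℓ rfl g5p
  have q16 := poly33_piece_low ((-E₀₀ / 64) : ℝ) hℓ hK hD₄' (by norm_num) g4p
  have q17 := poly33_piece_low ((-E₀₁ / 4 + E₁₀ / 8 - μ₂ / 4) : ℝ) hℓ hK hD₃' (by norm_num) g3p
  have q18 := poly33_piece_low ((-3 * E₀₂ / 4 + 3 * E₂₀ / 8) : ℝ) hℓ hK hD₂' (by norm_num) g2p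
  have q19 := poly33_piece_low ((-E₀₃ / 2 - 3 * E₁₂ / 2 + 3 * E₂₁ / 2 + 15 * μ₄ / 2) : ℝ) hℓ hK hD₁' (by norm_num) g1p
  have q20 := poly33_piece_low ((E₀₄ / 4 - 2 * E₁₃ + 3 * E₂₂ / 2) : ℝ) hℓ hK hD₀' (by norm_num) g0p
  have q21 := poly33_piece_main ((-1 / 64) : ℝ) hℓ rfl u3
  have q22 := poly33_piece_low ((-3 * E₀₀ / 32) : ℝ) hℓ hK hG₂ (by norm_num) u2
  have q23 := poly33_piece_low ((3 * E₀₁ / 4 - 9 * E₁₀ / 8 + 45 * μ₂ / 4) : ℝ) hℓ hK hG₁ (by norm_num) u1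
  have q24 := poly33_piece_low ((9 * E₀₂ / 4 - 3 * E₁₁ + 3 * E₂₀ / 8) : ℝ) hℓ hK hG₀ (by norm_num) u0
  have q25 := poly33_piece_hyp ((-1 / 384) : ℝ) hℓ (by norm_num) a3
  have q26 := poly33_piece_hyp ((-E₀₀ / 64) : ℝ) hℓ (by norm_num) a2
  have q27 := poly33_piece_hyp ((E₀₁ / 8 - 3 * E₁₀ / 16 + 15 * μ₂ / 8) : ℝ) hℓ (by norm_num) a1
  have q28 := poly33_piece_hyp ((3 * E₀₂ / 8 - E₁₁ / 2 + E₂₀ / 16) : ℝ) hℓ (by norm_num) a0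
  have q29 := poly33_piece_hyp ((-1 / 384) : ℝ) hℓ (by norm_num) b3
  have q30 := poly33_piece_hyp ((-E₀₀ / 64) : ℝ) hℓ (by norm_num) b2
  have q31 := poly33_piece_hyp ((E₀₁ / 8 - 3 * E₁₀ / 16 + 15 * μ₂ / 8) : ℝ) hℓ (by norm_num) b1
  have q32 := poly33_piece_hyp ((3 * E₀₂ / 8 - E₁₁ / 2 + E₂₀ / 16) : ℝ) hℓ (by norm_num) b0
  have q33 := poly33_piece_hyp ((1 / 128) : ℝ) hℓ (by norm_num) y1
  have q34 := poly33_piece_hyp ((E₀₀ / 64) : ℝ) hℓ (by norm_num) y0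
  have q35 := poly33_piece_hyp ((1 / 128) : ℝ) hℓ (by norm_num) z1
  have q36 := poly33_piece_hyp ((E₀₀ / 64) : ℝ) hℓ (by norm_num) z0
  have q37 := poly33_piece_hyp ((15 / 128) : ℝ) hℓ (by norm_num) r1
  have q38 := poly33_piece_hyp ((15 * E₀₀ / 64) : ℝ) hℓ (by norm_num) r0
  have q39 := poly33_piece_hyp ((15 / 128) : ℝ) hℓ (by norm_num) r1p
  have q40 := poly33_piece_hyp ((15 * E₀₀ / 64) : ℝ) hℓ (by norm_num) r0p
  have H2 := poly22_add_piece q1 q2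
  have H3 := poly22_add_piece H2 q3
  have H4 := poly22_add_piece H3 q4
  have H5 := poly22_add_piece H4 q5
  have H6 := poly22_add_piece H5 q6
  have H7 := poly22_add_piece H6 q7
  have H8 := poly22_add_piece H7 q8
  have H9 := poly22_add_piece H8 q9
  have H10 := poly22_add_piece H9 q10
  have H11 := poly22_add_piece H10 q11
  have H12 := poly22_add_piece H11 q12
  have H13 := poly22_add_piece H12 q13
  have H14 := poly22_add_piece H13 q14
  have H15 := poly22_add_piece H14 q15
  have H16 := poly22_add_piece H15 q16
  have H17 := poly22_add_piece H16 q17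
  have H18 := poly22_add_piece H17 q18
  have H19 := poly22_add_piece H18 q19
  have H20 := poly22_add_piece H19 q20
  have H21 := poly22_add_piece H20 q21
  have H22 := poly22_add_piece H21 q22
  have H23 := poly22_add_piece H22 q23
  have H24 := poly22_add_piece H23 q24
  have H25 := poly22_add_piece H24 q25
  have H26 := poly22_add_piece H25 q26
  have H27 := poly22_add_piece H26 q27
  have H28 := poly22_add_piece H27 q28
  have H29 := poly22_add_piece H28 q29
  have H30 := poly22_add_piece H29 q30
  have H31 := poly22_add_piece H30 q31
  have H32 := poly22_add_piece H31 q32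
  have H33 := poly22_add_piece H32 q33
  have H34 := poly22_add_piece H33 q34
  have H35 := poly22_add_piece H34 q35
  have H36 := poly22_add_piece H35 q36
  have H37 := poly22_add_piece H36 q37
  have H38 := poly22_add_piece H37 q38
  have H39 := poly22_add_piece H38 q39
  have H40 := poly22_add_piece H39 q40
  have hm : ∀ {x m₁ m₂ d : ℝ}, m₁ = m₂ → |x - m₁| ≤ d → |x - m₂| ≤ d := fun e h ↦ e ▸ h
  refine (hm ?_ H40).trans (le_of_eq ?_)
  · ring
  · ring

end Summit.Parity.GeneralizedHardyLittlewood.Theorems.MomentsBeyondDiagonal.DiagKernel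

end
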